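import Literature.Computability.QuantumComplexity.OneQubitEuler
import HarnessLib

/-!
# One-qubit linear algebra: two anticommuting reflections are `Z` and `X` up to a unitary

Topic `Literature/Computability/QuantumComplexity`, grouping namespace `OneQubit`. The geometric
heart of the first step of the universality proof of Boykin–Mor–Pulver–Roychowdhury–Vatan (FOCS
1999, §2–3): the two irrational rotations `σ_z^{-1/4}σ_x^{1/4} = e^{iλπ n̂₁·σ⃗}` and its conjugate
`e^{iλπ n̂₂·σ⃗}` have *orthogonal* axes, and "the local isomorphism between `SU(2)` and `SO(3)`"
lets one run the Euler decomposition about `n̂₁, n̂₂` instead of `ẑ, ŷ`. In matrix terms: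

* `pauliZ_eq_m2`, `pauliX_eq_m2`, `hGate_mul_pauliZ_mul_hGate` (`HZH = X`),
  `smul_one_add_smul_pauliZ` (`x•1 + y•Z = diag(x+y, x-y)`);
* `ofCols v w` — the one-qubit matrix with prescribed columns, and its algebra (`mul_ofCols`,
  `ofCols_mul_pauliZ`, `ofCols_mul_pauliX`, the Gram matrix `conjTranspose_ofCols_mul_ofCols`);
* **`exists_unitary_conj_pauli_eq`**: if `P, Q` are Hermitian with `P² = Q² = 1` and `PQ = -QP`
  (unit vectors `n̂₁ ⊥ n̂₂` in `P = n̂₁·σ⃗`, `Q = n̂₂·σ⃗`), then `P = W Z W†`, `Q = W X W†` for some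
  unitary `W` — take a unit `+1`-eigenvector `v` of `P` (a column of `1 + P ≠ 0`), `w = Qv`,
  `W = (v | w)`.

## References

* P. O. Boykin, T. Mor, M. Pulver, V. Roychowdhury, F. Vatan, *On universal and fault-tolerant
  quantum computing*, FOCS 1999, arXiv:quant-ph/9906054, §2 (local isomorphism `SU(2)`/`SO(3)`,
  Euler decompositions) and §3 (orthogonal axes `n̂₁ ⊥ n̂₂`) [BoykinEtAl1999].
* M. A. Nielsen, I. L. Chuang, *Quantum Computation and Quantum Information*, CUP 2010, §1.3.1,
  §4.2 (Pauli matrices, `HZH = X`, Ex. 4.18) [NielsenChuang2010].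
-/

noncomputable section

namespace Literature.Computability.QuantumComplexity.OneQubit

open Cryptography Matrix Complex

/-! ### The Pauli matrices `Z`, `X` by entries -/

/-- `Z = diag(1, -1)` by entries. [Nielsen–Chuang 2010, §1.3.1] [cite: NielsenChuang2010, §1.3.1] -/
theorem pauliZ_eq_m2 : pauliZ = m2 1 0 0 (-1) := by
  ext x y
  obtain rfl | rfl := eq_q0_or_eq_q1 x <;> obtain rfl | rfl := eq_q0_or_eq_q1 y <;>
    simp [pauliZ, q0_ne_q1, q0_ne_q1.symm]

/-- `X = [[0, 1], [1, 0]]` by entries. [Nielsen–Chuang 2010, §1.3.1] [cite: NielsenChuang2010, §1.3.1] -/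
theorem pauliX_eq_m2 : pauliX = m2 0 1 1 0 := by
  ext x y
  obtain rfl | rfl := eq_q0_or_eq_q1 x <;> obtain rfl | rfl := eq_q0_or_eq_q1 y <;> simp [pauliX]

/-- `H Z H = X` (Nielsen–Chuang 2010, Ex. 4.18). [cite: NielsenChuang2010, §4.2 Ex. 4.18] -/
theorem hGate_mul_pauliZ_mul_hGate : hGate * pauliZ * hGate = pauliX := by
  rw [hGate_eq_m2, pauliZ_eq_m2, pauliX_eq_m2, m2_mul_m2, m2_mul_m2, m2_inj]
  have h2 : invSqrt2 * invSqrt2 = 1 / 2 := invSqrt2_mul_invSqrt2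
  refine ⟨?_, ?_, ?_, ?_⟩
  · linear_combination (0 : ℂ) * h2
  · linear_combination (2 : ℂ) * h2
  · linear_combination (2 : ℂ) * h2
  · linear_combination (0 : ℂ) * h2

/-- `x • 1 + y • Z = diag(x + y, x - y)`; in particular `cos θ • 1 + (i sin θ) • Z = rz e^{iθ}`.
[folklore] -/
theorem smul_one_add_smul_pauliZ (x y : ℂ) :
    x • (1 : Matrix (QReg 1) (QReg 1) ℂ) + y • pauliZ = m2 (x + y) 0 0 (x - y) := by
  rw [one_eq_m2, pauliZ_eq_m2, smul_m2, smul_m2, m2_add_m2, m2_inj]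
  refine ⟨by ring, by ring, by ring, by ring⟩

/-! ### Matrices by columns -/

/-- The one-qubit matrix with columns `v` (column `|0⟩`) and `w` (column `|1⟩`). [folklore] -/
def ofCols (v w : QReg 1 → ℂ) : Matrix (QReg 1) (QReg 1) ℂ :=
  Matrix.of fun i k => if k 0 then w i else v i

/-- Entries of `ofCols`. [folklore] -/
theorem ofCols_apply (v w : QReg 1 → ℂ) (i k : QReg 1) :
    ofCols v w i k = if k 0 then w i else v i := rfl

/-- Left multiplication acts on the columns. [folklore] -/
theorem mul_ofCols (A : Matrix (QReg 1) (QReg 1) ℂ) (v w : QReg 1 → ℂ) :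
    A * ofCols v w = ofCols (A *ᵥ v) (A *ᵥ w) := by
  ext i k
  simp only [Matrix.mul_apply, ofCols_apply, Matrix.mulVec, dotProduct]
  obtain rfl | rfl := eq_q0_or_eq_q1 k <;> simp

/-- Right multiplication by `Z` negates the second column. [folklore] -/
theorem ofCols_mul_pauliZ (v w : QReg 1 → ℂ) : ofCols v w * pauliZ = ofCols v (-w) := by
  ext i k
  rw [Matrix.mul_apply, sum_qReg_one, pauliZ_eq_m2]
  obtain rfl | rfl := eq_q0_or_eq_q1 k <;> simp [ofCols_apply]

/-- Right multiplication by `X` swaps the columns. [folklore] -/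
theorem ofCols_mul_pauliX (v w : QReg 1 → ℂ) : ofCols v w * pauliX = ofCols w v := by
  ext i k
  rw [Matrix.mul_apply, sum_qReg_one, pauliX_eq_m2]
  obtain rfl | rfl := eq_q0_or_eq_q1 k <;> simp [ofCols_apply]

/-- The Gram matrix: `(ofCols v w)† (ofCols v' w')` has the inner products of the columns as
entries. [folklore] -/
theorem conjTranspose_ofCols_mul_ofCols (v w v' w' : QReg 1 → ℂ) :
    (ofCols v w)ᴴ * ofCols v' w' =
      m2 (star v ⬝ᵥ v') (star v ⬝ᵥ w') (star w ⬝ᵥ v') (star w ⬝ᵥ w') := by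
  ext i k
  rw [Matrix.mul_apply]
  simp only [Matrix.conjTranspose_apply, ofCols_apply, dotProduct, Pi.star_apply]
  obtain rfl | rfl := eq_q0_or_eq_q1 i <;> obtain rfl | rfl := eq_q0_or_eq_q1 k <;> simp

/-- The squared norm of a column: `v† v = |v₀|² + |v₁|²`. [folklore] -/
theorem star_dotProduct_self (v : QReg 1 → ℂ) :
    star v ⬝ᵥ v = ((‖v q0‖ ^ 2 + ‖v q1‖ ^ 2 : ℝ) : ℂ) := by
  rw [dotProduct, sum_qReg_one]
  simp only [Pi.star_apply, Complex.star_def, Complex.conj_mul', Complex.ofReal_add,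
    Complex.ofReal_pow]

/-! ### Two anticommuting reflections are simultaneously `Z` and `X` up to a unitary -/

/-- **Two anticommuting Hermitian involutions are conjugate to `(Z, X)`.** If `P, Q` are
Hermitian one-qubit matrices with `P² = Q² = 1` and `PQ = -QP` (i.e. `P = n̂₁·σ⃗`, `Q = n̂₂·σ⃗`
for orthogonal unit vectors `n̂₁ ⊥ n̂₂`), there is a unitary `W` with `W Z W† = P` and
`W X W† = Q`: take a unit `+1`-eigenvector `v` of `P` (a column of `1 + P ≠ 0`) and `w = Qv`,
a unit `-1`-eigenvector orthogonal to `v`; `W = (v | w)`. This realises the "local isomorphism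
between `SO(3)` and `SU(2)`" used by Boykin et al. (1999, §2–3) to transport the Euler
decomposition about `ẑ, ŷ` to the orthogonal axes `n̂₁, n̂₂`. [folklore] -/
theorem exists_unitary_conj_pauli_eq {P Q : Matrix (QReg 1) (QReg 1) ℂ} (hPh : Pᴴ = P)
    (hQh : Qᴴ = Q) (hP2 : P * P = 1) (hQ2 : Q * Q = 1) (hPQ : P * Q = -(Q * P)) :
    ∃ W ∈ Matrix.unitaryGroup (QReg 1) ℂ, W * pauliZ * star W = P ∧ W * pauliX * star W = Q := by
  -- `1 + P ≠ 0`
  have hE : (1 + P : Matrix (QReg 1) (QReg 1) ℂ) ≠ 0 := by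
    intro h
    have hP : P = -1 := (neg_eq_of_add_eq_zero_right h).symm
    have hQ0 : Q = 0 := by
      have h2 : (2 : ℂ) • Q = 0 := by
        rw [two_smul]
        have := hPQ
        rw [hP, neg_one_mul, mul_neg_one, neg_neg] at this
        -- this : -Q = Q
        nth_rewrite 1 [← this]
        exact neg_add_cancel Q
      exact (smul_eq_zero.1 h2).resolve_left two_ne_zero
    rw [hQ0, Matrix.zero_mul] at hQ2
    exact zero_ne_one hQ2
  obtain ⟨i₀, j, hij⟩ : ∃ i j, (1 + P : Matrix (QReg 1) (QReg 1) ℂ) i j ≠ 0 := by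
    by_contra h
    push Not at h
    exact hE (Matrix.ext h)
  -- a `+1`-eigenvector `u` of `P`
  set u : QReg 1 → ℂ := fun k => (1 + P : Matrix (QReg 1) (QReg 1) ℂ) k j with hu_def
  have hPu : P *ᵥ u = u := by
    have h1 : P *ᵥ u = fun k => (P * (1 + P)) k j := by
      funext k
      simp only [hu_def, Matrix.mulVec, dotProduct, Matrix.mul_apply]
    rw [h1, Matrix.mul_add, mul_one, hP2, add_comm]
  -- normalise
  set ν : ℝ := ‖u q0‖ ^ 2 + ‖u q1‖ ^ 2 with hν_def
  have hν : 0 < ν := by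
    have hne : u i₀ ≠ 0 := hij
    rcases eq_q0_or_eq_q1 i₀ with h0 | h1
    · rw [h0] at hne
      have : 0 < ‖u q0‖ ^ 2 := by positivity
      rw [hν_def]; positivity
    · rw [h1] at hne
      have : 0 < ‖u q1‖ ^ 2 := by positivity
      rw [hν_def]; positivity
  set r : ℝ := (Real.sqrt ν)⁻¹ with hr_def
  have hr2 : ((r : ℂ)) * r * ν = 1 := by
    rw [hr_def, ← Complex.ofReal_mul, ← Complex.ofReal_mul, ← mul_inv, Real.mul_self_sqrt hν.le,
      inv_mul_cancel₀ hν.ne']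
    simp
  set v : QReg 1 → ℂ := (r : ℂ) • u with hv_def
  have hPv : P *ᵥ v = v := by rw [hv_def, Matrix.mulVec_smul, hPu]
  have hvv : star v ⬝ᵥ v = 1 := by
    rw [star_dotProduct_self, hv_def]
    simp only [Pi.smul_apply, smul_eq_mul, norm_mul, Complex.norm_real, Real.norm_eq_abs, mul_pow,
      sq_abs]
    rw [← hr2, ← star_dotProduct_self u] at *
    rw [star_dotProduct_self u]
    push_cast
    ring
  -- `w = Q v`, a `-1`-eigenvector of `P`
  set w : QReg 1 → ℂ := Q *ᵥ v with hw_def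
  have hPw : P *ᵥ w = -w := by
    rw [hw_def, Matrix.mulVec_mulVec, hPQ, Matrix.neg_mulVec, ← Matrix.mulVec_mulVec, hPv]
  have hQw : Q *ᵥ w = v := by
    rw [hw_def, Matrix.mulVec_mulVec, hQ2, Matrix.one_mulVec]
  -- inner products
  have hww : star w ⬝ᵥ w = 1 := by
    rw [hw_def, Matrix.star_mulVec, ← Matrix.dotProduct_mulVec, Matrix.mulVec_mulVec, hQh, hQ2,
      Matrix.one_mulVec, hvv]
  have hvw : star v ⬝ᵥ w = 0 := by
    have h : star v ⬝ᵥ w = -(star v ⬝ᵥ w) := by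
      conv_lhs => rw [← hPv, Matrix.star_mulVec, ← Matrix.dotProduct_mulVec, hPh, hPw]
      rw [dotProduct_neg]
    have h2 : (2 : ℂ) * (star v ⬝ᵥ w) = 0 := by rw [two_mul]; nth_rewrite 2 [h]; ring
    exact (mul_eq_zero.1 h2).resolve_left two_ne_zero
  have hwv : star w ⬝ᵥ v = 0 := by
    rw [hw_def, Matrix.star_mulVec, ← Matrix.dotProduct_mulVec, hQh]
    exact hvw
  -- the unitary `W = (v | w)`
  set W := ofCols v w with hW_def
  have hW' : star W * W = 1 := by
    rw [hW_def, Matrix.star_eq_conjTranspose, conjTranspose_ofCols_mul_ofCols, hvv, hvw, hwv, hww,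
      one_eq_m2]
  have hWmem : W ∈ Matrix.unitaryGroup (QReg 1) ℂ := Matrix.mem_unitaryGroup_iff'.2 hW'
  have hW : W * star W = 1 := Matrix.mem_unitaryGroup_iff.1 hWmem
  refine ⟨W, hWmem, ?_, ?_⟩
  · have h1 : W * pauliZ = P * W := by
      rw [hW_def, ofCols_mul_pauliZ, mul_ofCols, hPv, hPw]
    rw [h1, mul_assoc, hW, mul_one]
  · have h1 : W * pauliX = Q * W := by
      rw [hW_def, ofCols_mul_pauliX, mul_ofCols, hQw]
    rw [h1, mul_assoc, hW, mul_one]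

end Literature.Computability.QuantumComplexity.OneQubit
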